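import Literature.AnabelianGeometry.SemiGraphs.Commensurability
import Literature.AnabelianGeometry.SemiGraphs.ArithFamilyHomNonVacuity
import Literature.AnabelianGeometry.SemiGraphs.HomCategory
import Literature.AnabelianGeometry.SemiGraphs.FiniteCoveringsComparison
import Literature.AnabelianGeometry.SemiGraphs.WitnessIwahoriLoop
import Literature.AnabelianGeometry.SemiGraphs.TemperoidsProductDecomposition
import Literature.AnabelianGeometry.SemiGraphs.TemperedAnabelianMorphisms
import Literature.AnabelianGeometry.SemiGraphs.TemperedAnabelianWitness
import Literature.AnabelianGeometry.SemiGraphs.Localizations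

/-!
# Non-vacuity witnesses for [SemiAnbd] interface records with no producer (NV-L3 batch, abc-iut cell)

Anti-vacuity companion (layer L3, row family «NV-L3/<Interface>», seat abc-iut-w4-d082 gen 3) to the
INHABITATION-CENSUS-L3-v1 of abc-iut-w4-d098 (42 Type-valued structures of
`Literature.AnabelianGeometry.SemiGraphs` with NO producer in the kernel: no definition, no projection, no
`Nonempty`/`∃` theorem).  Mochizuki, *Semi-graphs of anabelioids*, Publ. RIMS **42** (2006)
[cite: MochizukiSemiAnbd2006, Def. 2.3(iii) p.25].  PROOF-ONLY (0 definitions): every declaration is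
a `theorem` of the shape `Nonempty …` / `∃ …`, labelled HONESTLY in its name and docstring as

* `_model` — a genuine instance of the printed notion (e.g. the identity morphism of Def 5.1 (iv), the
  collection of trivial coverings of Def 2.3 (iii), an arbitrary family of open subgroups of bounded
  index);
* `_bookkeeping` — the record is a bookkeeping wrapper and the witness is the tautological one;
* `_parameterRecord` — a record of bare `Prop` flags / parameters, inhabited by a choice of values that
  asserts nothing (never to be cited as evidence beyond «the type is inhabited»).

A zero row of the census is «not yet witnessed», not «vacuous»; a witness here is «the type is
inhabited (by the stated object)», not an endorsement of any statement quantified over it.  Nothing in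
this file asserts a result of the paper; nothing here bears on [IUTchIII] Cor. 3.12.
-/

namespace Literature.AnabelianGeometry.SemiGraphs

open CategoryTheory CategoryTheory.PreGaloisCategory

universe v₁ u₁ u

/-! ### [SemiAnbd] Def 2.3 (iii): collections of finite étale coverings of degree `≤ M` -/

namespace SemiGraphOfAnabelioids

variable (𝒢 : SemiGraphOfAnabelioids.{v₁, u₁, u})

/-- **`CoveringCollection` is inhabited (`_model`, Def 2.3 (iii)):** over ANY choice of basepoints
(fibre functors `F_v`, `F_e` of the constituent anabelioids) ANY families `U_v ≤ Aut F_v`, `U_e ≤ Aut F_e`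
of open subgroups of index `≤ M` form a collection of finite étale coverings `ℋ_c → 𝒢_c` of degree `≤ M`
in the group-theoretic rendering of `Commensurability.lean` — the record has no further axiom.
[cite: MochizukiSemiAnbd2006, Def. 2.3(iii) p.25] -/
theorem exists_coveringCollection_model {M : ℕ}
    (FV : ∀ v : 𝒢.graph.Vertex, 𝒢.V v ⥤ FintypeCat.{v₁}) (fibV : ∀ v, FiberFunctor (FV v))
    (FE : ∀ e : 𝒢.graph.Edge, 𝒢.E e ⥤ FintypeCat.{v₁}) (fibE : ∀ e, FiberFunctor (FE e))
    (UV : ∀ v, Subgroup (Aut (FV v))) (UE : ∀ e, Subgroup (Aut (FE e)))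
    (hUV : ∀ v, IsOpen (UV v : Set (Aut (FV v)))) (hUE : ∀ e, IsOpen (UE e : Set (Aut (FE e))))
    (hiV : ∀ v, (UV v).index ≤ M) (hiE : ∀ e, (UE e).index ≤ M) :
    ∃ 𝒞 : CoveringCollection 𝒢 M, 𝒞.FV = FV ∧ 𝒞.FE = FE ∧ HEq 𝒞.UV UV ∧ HEq 𝒞.UE UE :=
  ⟨⟨FV, fibV, FE, fibE, UV, UE, hUV, hUE, hiV, hiE⟩, rfl, rfl, HEq.rfl, HEq.rfl⟩

/-- **The collection of TRIVIAL coverings (`_model`, Def 2.3 (iii)):** for every `M ≥ 1` the identity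
coverings `𝒢_c → 𝒢_c` (open subgroup `U_c := Π_c`, index `1 ≤ M`) over the fibre functors that exist
because every constituent is a Galois category (Mathlib `GaloisCategory.getFiberFunctor`) form a
`CoveringCollection 𝒢 M`; in particular the type is inhabited for every semi-graph of anabelioids.
[cite: MochizukiSemiAnbd2006, Def. 2.3(iii) p.25] -/
theorem nonempty_coveringCollection_trivialCoverings {M : ℕ} (hM : 1 ≤ M) :
    Nonempty (CoveringCollection 𝒢 M) := by
  refine ⟨⟨fun v => GaloisCategory.getFiberFunctor (𝒢.V v), fun v => inferInstance,
    fun e => GaloisCategory.getFiberFunctor (𝒢.E e), fun e => inferInstance,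
    fun _ => ⊤, fun _ => ⊤, fun _ => ?_, fun _ => ?_, fun _ => ?_, fun _ => ?_⟩⟩
  · simp
  · simp
  · simp [hM]
  · simp [hM]

/-- Conversely, over a vertex the bound `M` of an inhabited `CoveringCollection 𝒢 M` is `≥ 1`: an open
subgroup of the profinite group `Aut F_v` has finite, hence nonzero, index (`_model` sanity check: the
degree of a finite étale covering is `≥ 1`). [cite: MochizukiSemiAnbd2006, Def. 2.3(iii) p.25] -/
theorem one_le_of_coveringCollection {M : ℕ} (𝒞 : CoveringCollection 𝒢 M) (v : 𝒢.graph.Vertex) :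
    1 ≤ M := by
  haveI := 𝒞.fiberV v
  haveI : Finite (Aut (𝒞.FV v) ⧸ 𝒞.UV v) := Subgroup.quotient_finite_of_isOpen _ (𝒞.isOpen_UV v)
  haveI : (𝒞.UV v).FiniteIndex := Subgroup.finiteIndex_of_finite_quotient
  exact le_trans (Nat.one_le_iff_ne_zero.2 (𝒞.UV v).index_ne_zero_of_finite) (𝒞.index_UV v)

/-- Hence, for a semi-graph of anabelioids with at least one vertex, `CoveringCollection 𝒢 M` is inhabited
iff `1 ≤ M` — the exact inhabitation criterion of the record (`_model`).
[cite: MochizukiSemiAnbd2006, Def. 2.3(iii) p.25] -/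
theorem nonempty_coveringCollection_iff {M : ℕ} (v : 𝒢.graph.Vertex) :
    Nonempty (CoveringCollection 𝒢 M) ↔ 1 ≤ M :=
  ⟨fun ⟨𝒞⟩ => 𝒢.one_le_of_coveringCollection 𝒞 v,
    fun hM => 𝒢.nonempty_coveringCollection_trivialCoverings hM⟩

end SemiGraphOfAnabelioids

/-! ### [SemiAnbd] Def 5.1 (iv): morphisms of arithmetic semi-graphs of anabelioids (general case) -/

section ArithFamily

universe uO vO wO

variable {Obj : Type uO} [Category.{vO} Obj] {𝓥 : SemiAnbdVocab.{uO, vO, wO} Obj}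

namespace ArithFamilyHom

/-- **The adjectives of Def 5.1 (iv) at the identity morphism (`_model`; the record itself is witnessed by
abc-iut-w4-d098's `ArithFamilyHom.nonempty_id`, ArithFamilyHomNonVacuity.lean):** the identity family
morphism is *locally trivial*, *locally open* and *locally finite étale*, and its induced map on connected
components has finite (singleton), hence countable, fibres — so these adjective predicates of
`ArithFamilyHom` (and the fibre clauses of *finite étale* / *tempered*) are satisfiable at a genuine morphism;
the geometric clauses of *finite étale* / *tempered* at the identity additionally need the container's
`IsFiniteEtale (𝟙 _)` / `IsTempered (𝟙 _)`, which the abstract vocabulary `𝓥` does not supply.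
[cite: MochizukiSemiAnbd2006, Def 5.1 (iv), p. 63] -/
theorem exists_identity_model_adjectives (𝔉 : ArithSemiGraphFamily 𝓥) :
    ∃ Φ : ArithFamilyHom 𝓥 𝔉 𝔉, Φ.IsLocallyTrivial ∧ Φ.IsLocallyOpen ∧ Φ.IsLocallyFiniteEtale ∧
      (∀ j, Finite (Φ.toComp ⁻¹' {j})) ∧ ∀ j, Countable (Φ.toComp ⁻¹' {j}) := by
  refine ⟨⟨_root_.id, fun i => ArithHom.id (𝔉.comp i)⟩, fun i => ?_, fun i => ?_, fun i => ?_,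
    fun j => ?_, fun j => ?_⟩
  · exact ⟨𝓥.isLocallyTrivial_id _, Function.bijective_id⟩
  · change IsOpen (Set.range (MonoidHom.id _))
    rw [show Set.range (MonoidHom.id _) = Set.univ from Set.range_eq_univ.2 fun x => ⟨x, rfl⟩]
    exact isOpen_univ
  · refine ⟨𝓥.isLocallyFiniteEtale_of_isLocallyTrivial _ (𝓥.isLocallyTrivial_id _),
      Function.injective_id, ?_⟩
    change IsOpen (Set.range (MonoidHom.id _))
    rw [show Set.range (MonoidHom.id _) = Set.univ from Set.range_eq_univ.2 fun x => ⟨x, rfl⟩]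
    exact isOpen_univ
  · exact Set.Finite.to_subtype (Set.finite_singleton j |>.subset fun i hi => hi)
  · haveI : Finite (( _root_.id : 𝔉.ι → 𝔉.ι) ⁻¹' {j}) :=
      Set.Finite.to_subtype (Set.finite_singleton j |>.subset fun i hi => hi)
    infer_instance

end ArithFamilyHom

end ArithFamily

/-! ### [SemiAnbd] Rmk 2.4.2: objects of the 1-category of semi-graphs of anabelioids -/

namespace SgAQuot

/-- **`SgAQuot` is inhabited (`_bookkeeping`, Rmk 2.4.2):** the one-field wrapper holds every semi-graph of
anabelioids `𝒢` as an object of the 1-category with 2-isomorphism classes of 1-morphisms as arrows.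
[cite: MochizukiSemiAnbd2006, Rmk 2.4.2, p. 26] -/
theorem nonempty_of (𝒢 : SemiGraphOfAnabelioids.{v₁, u₁, u}) :
    ∃ X : SgAQuot.{v₁, u₁, u}, X.toSgA = 𝒢 :=
  ⟨⟨𝒢⟩, rfl⟩

/-- **An OUTRIGHT object of the 1-category of Rmk 2.4.2 (`_model`):** the semi-graph of anabelioids
`B(−)` of the profinite semi-graph of groups `𝒢₁` of `WitnessIwahoriLoop.lean` (the bouquet `H_1` with vertex
group `ℤ_2 ⋊ (1 + 2ℤ_2)`), via `ProfiniteSemiGraph.toAnab`; so `SgAQuot.{0, 1, 0}` is inhabited in the kernel.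
[cite: MochizukiSemiAnbd2006, Rmk 2.4.2, p. 26] -/
theorem nonempty_model : Nonempty SgAQuot.{0, 1, 0} :=
  ⟨⟨(IwahoriWitness.loopGraph 2).toAnab⟩⟩

end SgAQuot

/-! ### [SemiAnbd] Rmk 3.1.5: summands over an object (bookkeeping record of `TemperoidsProductDecomposition`) -/

namespace TemperoidProduct

/-- **`Summand P` is inhabited (`_bookkeeping`, Rmk 3.1.5):** the identity summand `(P, 𝟙 P)` of any object
`P` of any category; more generally every arrow `X ⟶ P` is a summand over `P` by definition of the record.
[cite: MochizukiSemiAnbd2006, Rmk 3.1.5 p.34] -/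
theorem Summand.exists_of_hom {E : Type u₁} [Category.{v₁} E] {P X : E} (f : X ⟶ P) :
    ∃ s : Summand P, s.X = X ∧ HEq s.leg f :=
  ⟨⟨X, f⟩, rfl, HEq.rfl⟩

/-- The identity summand (`_bookkeeping`). [cite: MochizukiSemiAnbd2006, Rmk 3.1.5 p.34] -/
theorem Summand.nonempty {E : Type u₁} [Category.{v₁} E] (P : E) : Nonempty (Summand P) :=
  ⟨⟨P, 𝟙 P⟩⟩

end TemperoidProduct

/-! ### [SemiAnbd] Thm 6.8 (iii)–(iv) / Cor 6.9: the arithmetic flags of `X_K` (parameter record) -/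

namespace TemperedCurve

variable {p : ℕ} [Fact p.Prime]

/-- **`CurveArithmeticFlags X` is inhabited at EVERY `X : TemperedCurve p` (`_parameterRecord`):** the record
consists of five bare `Prop`-valued flags ("once-punctured elliptic", "torsion closed points", "isogenous to
genus zero", "algebraic closed points", "defined over a number field") with NO axiom relating them to `X`, so
any choice of values inhabits it — here the all-`False` choice, which ASSERTS NOTHING about `X` and must never
be cited as evidence beyond «the type is inhabited» (the content lives in the ORIGIN certificate
`TemperedMorphismOrigin.IsFlagsOrigin`, FACT-policy). [cite: MochizukiSemiAnbd2006, Thm 6.8(iii)-(iv) pp.74-75] -/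
theorem nonempty_curveArithmeticFlags_parameterRecord (X : TemperedCurve p) :
    Nonempty (CurveArithmeticFlags X) :=
  ⟨⟨False, fun _ => False, False, fun _ => False, False⟩⟩

/-- The parameter record is inhabited OUTRIGHT, e.g. at the degenerate inhabitant `TemperedCurve.degenerate p`
of `TemperedAnabelianWitness.lean` (`_parameterRecord`; there `X̄_K` has no closed points, so the two
point-flags are the empty functions). [cite: MochizukiSemiAnbd2006, Thm 6.8(iii)-(iv) pp.74-75] -/
theorem exists_curveArithmeticFlags_parameterRecord (p : ℕ) [Fact p.Prime] :
    ∃ X : TemperedCurve p, Nonempty (CurveArithmeticFlags X) :=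
  ⟨TemperedCurve.degenerate p, nonempty_curveArithmeticFlags_parameterRecord _⟩

end TemperedCurve

/-! ### [SemiAnbd] §4 pp.51–52: objects and arrows of `Loc(𝔾, Γ)` -/

section Loc

universe uO vO wO

variable {Obj : Type uO} [Category.{vO} Obj] (𝓥 : SemiAnbdVocab.{uO, vO, wO} Obj)

namespace Loc

variable {G : Obj} {Γ : Subgroup (Aut G)}

/-- **The base object `𝔾` as a TEMPERED object of `Loc(𝔾, Γ)` (`_model`, CONDITIONAL on the two printed
inputs):** if `𝔾` is connected and the identity `𝔾 → 𝔾` is a tempered covering in the sense of the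
container `𝓥` (print: every finite étale covering is tempered, Def 3.5 (ii); the identity is the degree-1
finite étale covering), then `(𝔾, induced local (𝔾, Γ)-structure, str := 𝟙 𝔾)` is an object of `Loc(𝔾, Γ)`
— so `LocObj 𝓥 𝔾 Γ` is inhabited.  At the real vocabulary `SemiAnbdVocab.ofReal R` the second binder reads
`R.IsTempered (𝟙 𝔾)` (for `R := BridgeResidual.trivial`: `SgAQuot.finiteEtale (𝟙 𝔾)`, i.e. the identity
as a Def 2.2 (i) covering «local ∧ global ∧ aligned», not yet a theorem of the tree — recorded, not hidden).
[cite: MochizukiSemiAnbd2006, §4, pp. 51–52] -/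
theorem LocObj.exists_base_of_isTempered (hconn : 𝓥.IsConnected G) (htemp : 𝓥.IsTempered (𝟙 G)) :
    ∃ X : LocObj 𝓥 G Γ, X.U = G ∧ X.IsTemperedObj ∧ HEq X.str (some (𝟙 G)) := by
  have hlfe : 𝓥.IsLocallyFiniteEtale (𝟙 G) :=
    𝓥.isLocallyFiniteEtale_of_isLocallyTrivial _ (𝓥.isLocallyTrivial_id G)
  refine ⟨⟨G, LocalGStructure.induced 𝓥 (Γ := Γ) (𝟙 G) hlfe, some (𝟙 G), ?_, ?_⟩, rfl, rfl, HEq.rfl⟩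
  · rintro p hp
    obtain rfl : 𝟙 G = p := Option.some_injective _ hp
    exact ⟨hconn, htemp, hlfe, rfl⟩
  · intro h
    exact absurd h (Option.some_ne_none _)

/-- **The base object `𝔾` as a CLOSED object of `Loc(𝔾, Γ)` (`_model`, conditional):** if `𝔾` is connected
and the identity is finite étale for the container `𝓥`, then `𝔾 → 𝔾` is "a connected finite étale covering
of `𝔾`", i.e. a closed object (p.51). [cite: MochizukiSemiAnbd2006, §4, p. 51] -/
theorem LocObj.exists_closed_of_isFiniteEtale (hconn : 𝓥.IsConnected G)
    (hfin : 𝓥.IsFiniteEtale (𝟙 G)) :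
    ∃ X : LocObj 𝓥 G Γ, X.U = G ∧ X.IsClosed := by
  have hlfe : 𝓥.IsLocallyFiniteEtale (𝟙 G) :=
    𝓥.isLocallyFiniteEtale_of_isLocallyTrivial _ (𝓥.isLocallyTrivial_id G)
  refine ⟨⟨G, LocalGStructure.induced 𝓥 (Γ := Γ) (𝟙 G) hlfe, some (𝟙 G), ?_, ?_⟩, rfl,
    𝟙 G, rfl, hfin⟩
  · rintro p hp
    obtain rfl : 𝟙 G = p := Option.some_injective _ hp
    exact ⟨hconn, 𝓥.isTempered_of_isFiniteEtale _ hfin, hlfe, rfl⟩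
  · intro h
    exact absurd h (Option.some_ne_none _)

/-- **`LocHom` is inhabited at every object (`_model`): the identity arrow of `Loc(𝔾, Γ)`** (a locally
finite étale arrow over `𝔾`, compatible with the local `(𝔾, Γ)`-structures — the identity of the category
instance of `Localizations.lean`). [cite: MochizukiSemiAnbd2006, §4, p. 52] -/
theorem LocHom.nonempty_self (X : LocObj 𝓥 G Γ) : Nonempty (LocHom 𝓥 X X) :=
  ⟨𝟙 X⟩

/-- The identity arrow has the identity as underlying arrow of semi-graphs of anabelioids (so the witness
above is the genuine identity, not an arbitrary term). [cite: MochizukiSemiAnbd2006, §4, p. 52] -/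
theorem LocHom.exists_id (X : LocObj 𝓥 G Γ) : ∃ f : LocHom 𝓥 X X, f.hom = 𝟙 X.U :=
  ⟨𝟙 X, rfl⟩

/-- Hence, under the inputs of `LocObj.exists_base_of_isTempered`, BOTH records `LocObj` and `LocHom` of
`Loc(𝔾, Γ)` are inhabited (the base object and its identity). [cite: MochizukiSemiAnbd2006, §4, pp. 51–52] -/
theorem exists_locObj_locHom_of_isTempered (hconn : 𝓥.IsConnected G) (htemp : 𝓥.IsTempered (𝟙 G)) :
    ∃ X : LocObj 𝓥 G Γ, X.U = G ∧ Nonempty (LocHom 𝓥 X X) := by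
  obtain ⟨X, hU, -, -⟩ := LocObj.exists_base_of_isTempered 𝓥 (Γ := Γ) hconn htemp
  exact ⟨X, hU, LocHom.nonempty_self 𝓥 X⟩

end Loc

end Loc

end Literature.AnabelianGeometry.SemiGraphs
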